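import Literature.NumberTheory.DiophantineApproximation.RhinViolaExponents
import Literature.NumberTheory.DiophantineApproximation.RhinViolaConjugateDecompositions
import Literature.NumberTheory.DiophantineApproximation.RhinViolaLemma22
import Literature.NumberTheory.DiophantineApproximation.RhinViolaLemma24
import Literature.NumberTheory.DiophantineApproximation.RhinViolaLemma25
import Literature.NumberTheory.DiophantineApproximation.RhinViolaLemma26
import Literature.NumberTheory.LFunctions.LcmUptoCubeBound
import HarnessLib

/-!
# Rhin–Viola 2005, Theorem 2.1: the arithmetic of `I_z(h,j,k,l,m)`, `I_z^{(1)}`, `I_z^{(2)}`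

Topic `Literature/NumberTheory/DiophantineApproximation`. DEFINITIONS (`normaliser`, the witness structure
`Witness` and its constructors) and the PROVED theorem; no named facts. Source: G. Rhin, C. Viola,
*The permutation group method for the dilogarithm*, Ann. Sc. Norm. Super. Pisa Cl. Sci. (5) 4 (2005) 389–437,
Theorem 2.1 (p. 394) with its proof (pp. 395–410):

  **Theorem 2.1.** For integers `h, j, k, l, m ≥ 0` and real `z > 1`, with `H, K, α, β, δ` of (2.9),
  `d_H d_K z^α (z−1)^β I_z(h,j,k,l,m) = P(z) − Q(z) Li₂(1/z)`,
  `d_H d_K z^α (z−1)^β I_z^{(1)}(h,j,k,l,m) = R(z) − Q(z) Li₁(1/z)`,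
  `P, Q, R ∈ ℤ[z]`, `max{deg P, deg Q, deg R} ≤ δ`, and `Q(z) = d_H d_K z^α (z−1)^β I_z^{(2)}(h,j,k,l,m)`.

(`theorem21`; `I`, `I1`, `I2` are the tree's `RhinViola.I`, `RhinViola.I1`, `RhinViola.I2` — the contour
members in residue form — and `Li_s(1/z) = DilogPade.polylogSeries s (1/z)`.)

**Proof architecture (as in the paper, pp. 405–410).** Induction on `h+j+k+l+m`. If `min{l+m−j, j+k−m} < 0`,
Lemma 2.2 (`RhinViolaLemma22.lean`, `RhinViolaPolynomialCaseIntegrality.lean`; the second case via `I0_lam`).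
Otherwise: `km > 0` ⇒ the linear decomposition (2.29) with the bookkeeping (2.31) (`Witness.km`); `jl > 0` ⇒
(2.29)' (`Witness.jl`); `hl > 0` ⇒ (2.41) with (2.43) (`Witness.hl`); `hk > 0` ⇒ (2.41)' (`Witness.hk`) — the
paper obtains (2.29)', (2.41)' by conjugating with `λ`; the tree proves them directly
(`RhinViolaConjugateDecompositions.lean`). The degree bookkeeping (2.35)–(2.40), (2.44)–(2.45) is Lemma 2.8 in
the invariant form `δ = α + β + h − k − l` (`RhinViolaExponents.lean`). The terminal tuples
(`km = jl = hl = hk = 0`, `l+m ≥ j`, `j+k ≥ m`) are `(h,j,0,0,j)` (Lemma 2.7, which with `j = 0` also covers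
`(h,0,0,0,0)` and Lemma 2.3's `(0,0,0,0,0)`), `(0,0,k,l,0)` with `k > 0` (Lemma 2.6 for `l > 0`, Lemma 2.4 for
`l = 0`) and `(0,0,0,l,0)` (Lemma 2.5, from Lemma 2.4 by `λ`).

## References

* G. Rhin, C. Viola, Ann. Sc. Norm. Super. Pisa Cl. Sci. (5) 4 (2005) 389–437, Theorem 2.1, Lemmas 2.2–2.8,
  (2.29)–(2.45). [RhinViola2005]
-/

noncomputable section

namespace Literature.NumberTheory.DiophantineApproximation

namespace RhinViola

open Finset Polynomial
open DilogPade (polylogSeries)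
open Literature.NumberTheory.LFunctions (lcmUpto_dvd_lcmUpto_of_le)

/-! ### The normalising factor and the witness structure -/

/-- `d_H d_K z^α (z−1)^β` for the tuple `(h,j,k,l,m)`. [cite: RhinViola2005, Theorem 2.1] -/
def normaliser (h j k l m : ℕ) (z : ℝ) : ℝ :=
  (Nat.lcmUpto (bigH h j k l m) : ℝ) * Nat.lcmUpto (bigK h j k l m) * z ^ alpha h j k l m * (z - 1) ^ beta h j k l m

/-- **"Theorem 2.1 holds for `(h,j,k,l,m)`"** as data: the three integer polynomials with the degree bounds and
the three identities for all real `z > 1`. [cite: RhinViola2005, Theorem 2.1] -/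
structure Witness (h j k l m : ℕ) where
  /-- `P` -/
  P : ℤ[X]
  /-- `Q` -/
  Q : ℤ[X]
  /-- `R` -/
  R : ℤ[X]
  degP : P.natDegree ≤ delta h j k l m
  degQ : Q.natDegree ≤ delta h j k l m
  degR : R.natDegree ≤ delta h j k l m
  eqI : ∀ z : ℝ, 1 < z → normaliser h j k l m z * I z h j k l m = aeval z P - aeval z Q * polylogSeries 2 (1 / z)
  eqI1 : ∀ z : ℝ, 1 < z → normaliser h j k l m z * I1 z h j k l m = aeval z R - aeval z Q * polylogSeries 1 (1 / z)
  eqI2 : ∀ z : ℝ, 1 < z → normaliser h j k l m z * I2 z h j k l m = aeval z Q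


/-- The normaliser is positive for `z > 1`. [folklore] -/
theorem normaliser_ne_zero (h j k l m : ℕ) {z : ℝ} (hz : 1 < z) : normaliser h j k l m z ≠ 0 := by
  have h1 := Nat.lcmUpto_pos (bigH h j k l m)
  have h2 := Nat.lcmUpto_pos (bigK h j k l m)
  unfold normaliser
  have : (0 : ℝ) < z - 1 := by linarith
  positivity

/-- The integer `(d_H/d_{H'})(d_K/d_{K'})` for a parent tuple and a child tuple. [cite: RhinViola2005, (2.32)] -/
def lcmRatio (h j k l m h' j' k' l' m' : ℕ) : ℕ :=
  Nat.lcmUpto (bigH h j k l m) / Nat.lcmUpto (bigH h' j' k' l' m') *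
    (Nat.lcmUpto (bigK h j k l m) / Nat.lcmUpto (bigK h' j' k' l' m'))

/-- **Ratio of normalisers along a decomposition step**: if `H' ≤ H`, `K' ≤ K`, `α' + s ≤ α`, `β' ≤ β + t`, then
`d_H d_K z^α (z−1)^β (z−1)^t = ((d_H/d_{H'})(d_K/d_{K'})) z^{α−s−α'} (z−1)^{β+t−β'} · z^s · d_{H'} d_{K'} z^{α'}(z−1)^{β'}`.
[cite: RhinViola2005, (2.31)–(2.32) and (2.43)] -/
theorem normaliser_eq {h j k l m h' j' k' l' m' s t : ℕ} (hH : bigH h' j' k' l' m' ≤ bigH h j k l m)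
    (hK : bigK h' j' k' l' m' ≤ bigK h j k l m) (hα : alpha h' j' k' l' m' + s ≤ alpha h j k l m)
    (hβ : beta h' j' k' l' m' ≤ beta h j k l m + t) (z : ℝ) :
    normaliser h j k l m z * (z - 1) ^ t =
      (lcmRatio h j k l m h' j' k' l' m' : ℝ) *
        z ^ (alpha h j k l m - s - alpha h' j' k' l' m') * (z - 1) ^ (beta h j k l m + t - beta h' j' k' l' m') *
        (z ^ s * normaliser h' j' k' l' m' z) := by
  unfold normaliser lcmRatio
  rw [Nat.cast_mul, Nat.cast_div_charZero (lcmUpto_dvd_lcmUpto_of_le hH), Nat.cast_div_charZero (lcmUpto_dvd_lcmUpto_of_le hK)]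
  have e1 : z ^ alpha h j k l m = z ^ (alpha h j k l m - s - alpha h' j' k' l' m') * z ^ s * z ^ alpha h' j' k' l' m' := by
    rw [← pow_add, ← pow_add]; congr 1; omega
  have e2 : (z - 1) ^ beta h j k l m * (z - 1) ^ t =
      (z - 1) ^ (beta h j k l m + t - beta h' j' k' l' m') * (z - 1) ^ beta h' j' k' l' m' := by
    rw [← pow_add, ← pow_add]; congr 1; omega
  have h1 : (Nat.lcmUpto (bigH h' j' k' l' m') : ℝ) ≠ 0 := by exact_mod_cast (Nat.lcmUpto_pos _).ne'
  have h2 : (Nat.lcmUpto (bigK h' j' k' l' m') : ℝ) ≠ 0 := by exact_mod_cast (Nat.lcmUpto_pos _).ne'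
  rw [mul_assoc _ ((z - 1) ^ beta h j k l m), e2, e1]
  field_simp

/-! ### Transfer along equal data (Lemma 2.5 and the `λ`-case of Lemma 2.2) -/

/-- A witness transfers between tuples with the same exponents and the same integrals. [cite: RhinViola2005, (2.6)–(2.9)] -/
def Witness.transfer {h j k l m h' j' k' l' m' : ℕ} (W : Witness h' j' k' l' m')
    (hH : bigH h j k l m = bigH h' j' k' l' m') (hK : bigK h j k l m = bigK h' j' k' l' m')
    (hα : alpha h j k l m = alpha h' j' k' l' m') (hβ : beta h j k l m = beta h' j' k' l' m')
    (hδ : delta h j k l m = delta h' j' k' l' m')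
    (hI : ∀ z : ℝ, 1 < z → I z h j k l m = I z h' j' k' l' m')
    (hI1 : ∀ z : ℝ, 1 < z → I1 z h j k l m = I1 z h' j' k' l' m')
    (hI2 : ∀ z : ℝ, 1 < z → I2 z h j k l m = I2 z h' j' k' l' m') : Witness h j k l m where
  P := W.P
  Q := W.Q
  R := W.R
  degP := hδ ▸ W.degP
  degQ := hδ ▸ W.degQ
  degR := hδ ▸ W.degR
  eqI z hz := by rw [normaliser, hH, hK, hα, hβ, hI z hz, ← W.eqI z hz, normaliser]
  eqI1 z hz := by rw [normaliser, hH, hK, hα, hβ, hI1 z hz, ← W.eqI1 z hz, normaliser]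
  eqI2 z hz := by rw [normaliser, hH, hK, hα, hβ, hI2 z hz, ← W.eqI2 z hz, normaliser]

/-! ### Combination along a linear decomposition -/

/-- Degree of `C r X^a (X−1)^b P`. [folklore] -/
theorem natDegree_C_mul_X_pow_mul_le (r : ℤ) (a b : ℕ) (P : ℤ[X]) :
    (C r * X ^ a * (X - 1) ^ b * P).natDegree ≤ a + b + P.natDegree := by
  refine natDegree_mul_le.trans (add_le_add ?_ le_rfl)
  refine natDegree_mul_le.trans (add_le_add ?_ ?_)
  · exact (natDegree_C_mul_le _ _).trans (natDegree_X_pow a).le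
  · have := natDegree_pow_le_of_le b (show (X - 1 : ℤ[X]).natDegree ≤ 1 from (natDegree_sub_le _ _).trans (by simp))
    simpa using this

/-- Evaluation of `C r X^a (X−1)^b P`. [folklore] -/
theorem aeval_C_mul_X_pow_mul (r : ℤ) (a b : ℕ) (P : ℤ[X]) (z : ℝ) :
    aeval z (C r * X ^ a * (X - 1) ^ b * P) = (r : ℝ) * z ^ a * (z - 1) ^ b * aeval z P := by
  simp [map_mul, map_pow, map_sub, aeval_X]

/-- **Two-child combination** ((2.32)–(2.34)): if `N_T I^{(ν)}(T) = Σ_q c_q z^{a_q}(z−1)^{b_q} · N_q I^{(ν)}(q)`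
for `ν = 0,1,2` with the same coefficients, and `a_q + b_q + δ_q ≤ δ_T`, witnesses for the children give one for `T`.
[cite: RhinViola2005, (2.32)–(2.36)] -/
def Witness.combine₂ {h j k l m h₁ j₁ k₁ l₁ m₁ h₂ j₂ k₂ l₂ m₂ : ℕ} (W₁ : Witness h₁ j₁ k₁ l₁ m₁)
    (W₂ : Witness h₂ j₂ k₂ l₂ m₂) (r₁ r₂ : ℤ) (a₁ b₁ a₂ b₂ : ℕ)
    (hd₁ : a₁ + b₁ + delta h₁ j₁ k₁ l₁ m₁ ≤ delta h j k l m) (hd₂ : a₂ + b₂ + delta h₂ j₂ k₂ l₂ m₂ ≤ delta h j k l m)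
    (hI : ∀ z : ℝ, 1 < z → normaliser h j k l m z * I z h j k l m =
      (r₁ : ℝ) * z ^ a₁ * (z - 1) ^ b₁ * (normaliser h₁ j₁ k₁ l₁ m₁ z * I z h₁ j₁ k₁ l₁ m₁) +
        (r₂ : ℝ) * z ^ a₂ * (z - 1) ^ b₂ * (normaliser h₂ j₂ k₂ l₂ m₂ z * I z h₂ j₂ k₂ l₂ m₂))
    (hI1 : ∀ z : ℝ, 1 < z → normaliser h j k l m z * I1 z h j k l m =
      (r₁ : ℝ) * z ^ a₁ * (z - 1) ^ b₁ * (normaliser h₁ j₁ k₁ l₁ m₁ z * I1 z h₁ j₁ k₁ l₁ m₁) +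
        (r₂ : ℝ) * z ^ a₂ * (z - 1) ^ b₂ * (normaliser h₂ j₂ k₂ l₂ m₂ z * I1 z h₂ j₂ k₂ l₂ m₂))
    (hI2 : ∀ z : ℝ, 1 < z → normaliser h j k l m z * I2 z h j k l m =
      (r₁ : ℝ) * z ^ a₁ * (z - 1) ^ b₁ * (normaliser h₁ j₁ k₁ l₁ m₁ z * I2 z h₁ j₁ k₁ l₁ m₁) +
        (r₂ : ℝ) * z ^ a₂ * (z - 1) ^ b₂ * (normaliser h₂ j₂ k₂ l₂ m₂ z * I2 z h₂ j₂ k₂ l₂ m₂)) :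
    Witness h j k l m where
  P := C r₁ * X ^ a₁ * (X - 1) ^ b₁ * W₁.P + C r₂ * X ^ a₂ * (X - 1) ^ b₂ * W₂.P
  Q := C r₁ * X ^ a₁ * (X - 1) ^ b₁ * W₁.Q + C r₂ * X ^ a₂ * (X - 1) ^ b₂ * W₂.Q
  R := C r₁ * X ^ a₁ * (X - 1) ^ b₁ * W₁.R + C r₂ * X ^ a₂ * (X - 1) ^ b₂ * W₂.R
  degP := (natDegree_add_le _ _).trans (max_le
    ((natDegree_C_mul_X_pow_mul_le _ _ _ _).trans (by have := W₁.degP; omega))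
    ((natDegree_C_mul_X_pow_mul_le _ _ _ _).trans (by have := W₂.degP; omega)))
  degQ := (natDegree_add_le _ _).trans (max_le
    ((natDegree_C_mul_X_pow_mul_le _ _ _ _).trans (by have := W₁.degQ; omega))
    ((natDegree_C_mul_X_pow_mul_le _ _ _ _).trans (by have := W₂.degQ; omega)))
  degR := (natDegree_add_le _ _).trans (max_le
    ((natDegree_C_mul_X_pow_mul_le _ _ _ _).trans (by have := W₁.degR; omega))
    ((natDegree_C_mul_X_pow_mul_le _ _ _ _).trans (by have := W₂.degR; omega)))
  eqI z hz := by
    rw [hI z hz, W₁.eqI z hz, W₂.eqI z hz, map_add, map_add, aeval_C_mul_X_pow_mul, aeval_C_mul_X_pow_mul,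
      aeval_C_mul_X_pow_mul, aeval_C_mul_X_pow_mul]
    ring
  eqI1 z hz := by
    rw [hI1 z hz, W₁.eqI1 z hz, W₂.eqI1 z hz, map_add, map_add, aeval_C_mul_X_pow_mul, aeval_C_mul_X_pow_mul,
      aeval_C_mul_X_pow_mul, aeval_C_mul_X_pow_mul]
    ring
  eqI2 z hz := by
    rw [hI2 z hz, W₁.eqI2 z hz, W₂.eqI2 z hz, map_add, aeval_C_mul_X_pow_mul, aeval_C_mul_X_pow_mul]

/-- **Three-child combination** ((2.41)–(2.45)). [cite: RhinViola2005, (2.41)–(2.45)] -/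
def Witness.combine₃ {h j k l m h₃ j₃ k₃ l₃ m₃ h₄ j₄ k₄ l₄ m₄ h₅ j₅ k₅ l₅ m₅ : ℕ} (W₃ : Witness h₃ j₃ k₃ l₃ m₃)
    (W₄ : Witness h₄ j₄ k₄ l₄ m₄) (W₅ : Witness h₅ j₅ k₅ l₅ m₅) (r₃ r₄ r₅ : ℤ) (a₃ b₃ a₄ b₄ a₅ b₅ : ℕ)
    (hd₃ : a₃ + b₃ + delta h₃ j₃ k₃ l₃ m₃ ≤ delta h j k l m) (hd₄ : a₄ + b₄ + delta h₄ j₄ k₄ l₄ m₄ ≤ delta h j k l m)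
    (hd₅ : a₅ + b₅ + delta h₅ j₅ k₅ l₅ m₅ ≤ delta h j k l m)
    (hI : ∀ z : ℝ, 1 < z → normaliser h j k l m z * I z h j k l m =
      (r₃ : ℝ) * z ^ a₃ * (z - 1) ^ b₃ * (normaliser h₃ j₃ k₃ l₃ m₃ z * I z h₃ j₃ k₃ l₃ m₃) +
        (r₄ : ℝ) * z ^ a₄ * (z - 1) ^ b₄ * (normaliser h₄ j₄ k₄ l₄ m₄ z * I z h₄ j₄ k₄ l₄ m₄) +
        (r₅ : ℝ) * z ^ a₅ * (z - 1) ^ b₅ * (normaliser h₅ j₅ k₅ l₅ m₅ z * I z h₅ j₅ k₅ l₅ m₅))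
    (hI1 : ∀ z : ℝ, 1 < z → normaliser h j k l m z * I1 z h j k l m =
      (r₃ : ℝ) * z ^ a₃ * (z - 1) ^ b₃ * (normaliser h₃ j₃ k₃ l₃ m₃ z * I1 z h₃ j₃ k₃ l₃ m₃) +
        (r₄ : ℝ) * z ^ a₄ * (z - 1) ^ b₄ * (normaliser h₄ j₄ k₄ l₄ m₄ z * I1 z h₄ j₄ k₄ l₄ m₄) +
        (r₅ : ℝ) * z ^ a₅ * (z - 1) ^ b₅ * (normaliser h₅ j₅ k₅ l₅ m₅ z * I1 z h₅ j₅ k₅ l₅ m₅))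
    (hI2 : ∀ z : ℝ, 1 < z → normaliser h j k l m z * I2 z h j k l m =
      (r₃ : ℝ) * z ^ a₃ * (z - 1) ^ b₃ * (normaliser h₃ j₃ k₃ l₃ m₃ z * I2 z h₃ j₃ k₃ l₃ m₃) +
        (r₄ : ℝ) * z ^ a₄ * (z - 1) ^ b₄ * (normaliser h₄ j₄ k₄ l₄ m₄ z * I2 z h₄ j₄ k₄ l₄ m₄) +
        (r₅ : ℝ) * z ^ a₅ * (z - 1) ^ b₅ * (normaliser h₅ j₅ k₅ l₅ m₅ z * I2 z h₅ j₅ k₅ l₅ m₅)) :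
    Witness h j k l m where
  P := C r₃ * X ^ a₃ * (X - 1) ^ b₃ * W₃.P + C r₄ * X ^ a₄ * (X - 1) ^ b₄ * W₄.P + C r₅ * X ^ a₅ * (X - 1) ^ b₅ * W₅.P
  Q := C r₃ * X ^ a₃ * (X - 1) ^ b₃ * W₃.Q + C r₄ * X ^ a₄ * (X - 1) ^ b₄ * W₄.Q + C r₅ * X ^ a₅ * (X - 1) ^ b₅ * W₅.Q
  R := C r₃ * X ^ a₃ * (X - 1) ^ b₃ * W₃.R + C r₄ * X ^ a₄ * (X - 1) ^ b₄ * W₄.R + C r₅ * X ^ a₅ * (X - 1) ^ b₅ * W₅.R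
  degP := (natDegree_add_le _ _).trans (max_le ((natDegree_add_le _ _).trans (max_le
    ((natDegree_C_mul_X_pow_mul_le _ _ _ _).trans (by have := W₃.degP; omega))
    ((natDegree_C_mul_X_pow_mul_le _ _ _ _).trans (by have := W₄.degP; omega))))
    ((natDegree_C_mul_X_pow_mul_le _ _ _ _).trans (by have := W₅.degP; omega)))
  degQ := (natDegree_add_le _ _).trans (max_le ((natDegree_add_le _ _).trans (max_le
    ((natDegree_C_mul_X_pow_mul_le _ _ _ _).trans (by have := W₃.degQ; omega))
    ((natDegree_C_mul_X_pow_mul_le _ _ _ _).trans (by have := W₄.degQ; omega))))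
    ((natDegree_C_mul_X_pow_mul_le _ _ _ _).trans (by have := W₅.degQ; omega)))
  degR := (natDegree_add_le _ _).trans (max_le ((natDegree_add_le _ _).trans (max_le
    ((natDegree_C_mul_X_pow_mul_le _ _ _ _).trans (by have := W₃.degR; omega))
    ((natDegree_C_mul_X_pow_mul_le _ _ _ _).trans (by have := W₄.degR; omega))))
    ((natDegree_C_mul_X_pow_mul_le _ _ _ _).trans (by have := W₅.degR; omega)))
  eqI z hz := by
    rw [hI z hz, W₃.eqI z hz, W₄.eqI z hz, W₅.eqI z hz]
    simp only [map_add, aeval_C_mul_X_pow_mul]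
    ring
  eqI1 z hz := by
    rw [hI1 z hz, W₃.eqI1 z hz, W₄.eqI1 z hz, W₅.eqI1 z hz]
    simp only [map_add, aeval_C_mul_X_pow_mul]
    ring
  eqI2 z hz := by
    rw [hI2 z hz, W₃.eqI2 z hz, W₄.eqI2 z hz, W₅.eqI2 z hz]
    simp only [map_add, aeval_C_mul_X_pow_mul]

/-! ### The four inductive steps -/

/-- **(2.29) with (2.31)**: witnesses for `(h,j,k,l,m)` and `(h,j,k,l+1,m)` give one for `(h,j,k+1,l,m+1)`.
[cite: RhinViola2005, (2.29)–(2.40)] -/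
def Witness.km {h j k l m : ℕ} (W₁ : Witness h j k l m) (W₂ : Witness h j k (l + 1) m) :
    Witness h j (k + 1) l (m + 1) := by
  obtain ⟨hH1, hK1, hH2, hK2, hα1, hβ1, hα2, hβ2, hδ1, hδ2⟩ := bookkeeping_km h j k l m
  have e1 := fun z : ℝ => normaliser_eq (s := 1) (t := 0) hH1 hK1 hα1 (by simpa using hβ1) z
  have e2 := fun z : ℝ => normaliser_eq (s := 0) (t := 0) hH2 hK2 (by simpa using hα2) (by simpa using hβ2) z
  refine Witness.combine₂ W₁ W₂ (lcmRatio h j (k + 1) l (m + 1) h j k l m)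
    (-(lcmRatio h j (k + 1) l (m + 1) h j k (l + 1) m : ℤ)) _ _ _ _ hδ1 (by simpa using hδ2)
    (fun z hz => ?_) (fun z hz => ?_) (fun z hz => ?_)
  all_goals
    have hz0 : z ≠ 0 := by positivity
    have h1 := e1 z
    have h2 := e2 z
    simp only [pow_zero, mul_one, pow_one, add_zero, Nat.sub_zero, one_mul] at h1 h2
    push_cast
  · rw [I_succ_k_succ_m hz]
    linear_combination (norm := skip) (z⁻¹ * I z h j k l m) * h1 - I z h j k (l + 1) m * h2
    field_simp
    ring
  · rw [I1_succ_k_succ_m hz]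
    linear_combination (norm := skip) (z⁻¹ * I1 z h j k l m) * h1 - I1 z h j k (l + 1) m * h2
    field_simp
    ring
  · rw [I2_succ_k_succ_m hz0]
    linear_combination (norm := skip) (z⁻¹ * I2 z h j k l m) * h1 - I2 z h j k (l + 1) m * h2
    field_simp
    ring

/-- **(2.29)' with (2.31)'**: witnesses for `(h,j,k,l,m)` and `(h,j,k+1,l,m)` give one for `(h,j+1,k,l+1,m)`.
[cite: RhinViola2005, p. 408] -/
def Witness.jl {h j k l m : ℕ} (W₁ : Witness h j k l m) (W₂ : Witness h j (k + 1) l m) :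
    Witness h (j + 1) k (l + 1) m := by
  obtain ⟨hH1, hK1, hH2, hK2, hα1, hβ1, hα2, hβ2, hδ1, hδ2⟩ := bookkeeping_jl h j k l m
  have e1 := fun z : ℝ => normaliser_eq (s := 1) (t := 0) hH1 hK1 hα1 (by simpa using hβ1) z
  have e2 := fun z : ℝ => normaliser_eq (s := 0) (t := 0) hH2 hK2 (by simpa using hα2) (by simpa using hβ2) z
  refine Witness.combine₂ W₁ W₂ (lcmRatio h (j + 1) k (l + 1) m h j k l m)
    (-(lcmRatio h (j + 1) k (l + 1) m h j (k + 1) l m : ℤ)) _ _ _ _ hδ1 (by simpa using hδ2)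
    (fun z hz => ?_) (fun z hz => ?_) (fun z hz => ?_)
  all_goals
    have hz0 : z ≠ 0 := by positivity
    have h1 := e1 z
    have h2 := e2 z
    simp only [pow_zero, mul_one, pow_one, add_zero, Nat.sub_zero, one_mul] at h1 h2
    push_cast
  · rw [I_succ_j_succ_l hz]
    linear_combination (norm := skip) (z⁻¹ * I z h j k l m) * h1 - I z h j (k + 1) l m * h2
    field_simp
    ring
  · rw [I1_succ_j_succ_l hz]
    linear_combination (norm := skip) (z⁻¹ * I1 z h j k l m) * h1 - I1 z h j (k + 1) l m * h2
    field_simp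
    ring
  · rw [I2_succ_j_succ_l hz0]
    linear_combination (norm := skip) (z⁻¹ * I2 z h j k l m) * h1 - I2 z h j (k + 1) l m * h2
    field_simp
    ring

/-- **(2.41) with (2.43)**: witnesses for `(h,j,k,l,m)`, `(h,j,k,l+1,m)`, `(h,j,k,l,m+1)` give one for
`(h+1,j,k,l+1,m)`. [cite: RhinViola2005, (2.41)–(2.45)] -/
def Witness.hl {h j k l m : ℕ} (W₃ : Witness h j k l m) (W₄ : Witness h j k (l + 1) m) (W₅ : Witness h j k l (m + 1)) :
    Witness (h + 1) j k (l + 1) m := by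
  obtain ⟨hH3, hK3, hH4, hK4, hH5, hK5, hα3, hβ3, hα4, hβ4, hα5, hβ5, hδ3, hδ4, hδ5⟩ := bookkeeping_hl h j k l m
  have e3 := fun z : ℝ => normaliser_eq (s := 0) (t := 0) hH3 hK3 (by simpa using hα3) (by simpa using hβ3) z
  have e4 := fun z : ℝ => normaliser_eq (s := 0) (t := 1) hH4 hK4 (by simpa using hα4) hβ4 z
  have e5 := fun z : ℝ => normaliser_eq (s := 0) (t := 0) hH5 hK5 (by simpa using hα5) (by simpa using hβ5) z
  refine Witness.combine₃ W₃ W₄ W₅ (lcmRatio (h + 1) j k (l + 1) m h j k l m)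
    (-(lcmRatio (h + 1) j k (l + 1) m h j k (l + 1) m : ℤ)) (-(lcmRatio (h + 1) j k (l + 1) m h j k l (m + 1) : ℤ))
    _ _ _ _ _ _ (by simpa using hδ3) (by simpa using hδ4) (by simpa using hδ5)
    (fun z hz => ?_) (fun z hz => ?_) (fun z hz => ?_)
  all_goals
    have hz0 : z ≠ 0 := by positivity
    have h3 := e3 z
    have h4 := e4 z
    have h5 := e5 z
    simp only [pow_zero, mul_one, pow_one, add_zero, Nat.sub_zero, one_mul] at h3 h4 h5
    push_cast
  · rw [I_succ_h_succ_l hz]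
    linear_combination I z h j k l m * h3 - I z h j k (l + 1) m * h4 - I z h j k l (m + 1) * h5
  · rw [I1_succ_h_succ_l hz]
    linear_combination I1 z h j k l m * h3 - I1 z h j k (l + 1) m * h4 - I1 z h j k l (m + 1) * h5
  · rw [I2_succ_h_succ_l hz0]
    linear_combination I2 z h j k l m * h3 - I2 z h j k (l + 1) m * h4 - I2 z h j k l (m + 1) * h5

/-- **(2.41)' with (2.43)'**: witnesses for `(h,j,k,l,m)`, `(h,j,k+1,l,m)`, `(h,j+1,k,l,m)` give one for
`(h+1,j,k+1,l,m)`. [cite: RhinViola2005, p. 409] -/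
def Witness.hk {h j k l m : ℕ} (W₃ : Witness h j k l m) (W₄ : Witness h j (k + 1) l m) (W₅ : Witness h (j + 1) k l m) :
    Witness (h + 1) j (k + 1) l m := by
  obtain ⟨hH3, hK3, hH4, hK4, hH5, hK5, hα3, hβ3, hα4, hβ4, hα5, hβ5, hδ3, hδ4, hδ5⟩ := bookkeeping_hk h j k l m
  have e3 := fun z : ℝ => normaliser_eq (s := 0) (t := 0) hH3 hK3 (by simpa using hα3) (by simpa using hβ3) z
  have e4 := fun z : ℝ => normaliser_eq (s := 0) (t := 1) hH4 hK4 (by simpa using hα4) hβ4 z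
  have e5 := fun z : ℝ => normaliser_eq (s := 0) (t := 0) hH5 hK5 (by simpa using hα5) (by simpa using hβ5) z
  refine Witness.combine₃ W₃ W₄ W₅ (lcmRatio (h + 1) j (k + 1) l m h j k l m)
    (-(lcmRatio (h + 1) j (k + 1) l m h j (k + 1) l m : ℤ)) (-(lcmRatio (h + 1) j (k + 1) l m h (j + 1) k l m : ℤ))
    _ _ _ _ _ _ (by simpa using hδ3) (by simpa using hδ4) (by simpa using hδ5)
    (fun z hz => ?_) (fun z hz => ?_) (fun z hz => ?_)
  all_goals
    have hz0 : z ≠ 0 := by positivity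
    have h3 := e3 z
    have h4 := e4 z
    have h5 := e5 z
    simp only [pow_zero, mul_one, pow_one, add_zero, Nat.sub_zero, one_mul] at h3 h4 h5
    push_cast
  · rw [I_succ_h_succ_k hz]
    linear_combination I z h j k l m * h3 - I z h j (k + 1) l m * h4 - I z h (j + 1) k l m * h5
  · rw [I1_succ_h_succ_k hz]
    linear_combination I1 z h j k l m * h3 - I1 z h j (k + 1) l m * h4 - I1 z h (j + 1) k l m * h5
  · rw [I2_succ_h_succ_k z]
    linear_combination I2 z h j k l m * h3 - I2 z h j (k + 1) l m * h4 - I2 z h (j + 1) k l m * h5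

/-! ### The terminal tuples -/

/-- Lemma 2.7: a witness for `(h, j, 0, 0, j)` (including `(h,0,0,0,0)` and Lemma 2.3's `(0,0,0,0,0)`).
[cite: RhinViola2005, Lemma 2.7 and Lemma 2.3] -/
theorem nonempty_witness_h_j_zero_zero_j (h j : ℕ) : Nonempty (Witness h j 0 0 j) := by
  obtain ⟨P, Q, R, hP, hQ, hR, hid⟩ := lemma27 h j
  obtain ⟨eH, eK, eα, eβ, eδ⟩ := exponents_h_j_zero_zero_j h j
  have hN : ∀ z : ℝ, normaliser h j 0 0 j z = (Nat.lcmUpto (h + j) : ℝ) * Nat.lcmUpto (h + j) * z ^ j := by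
    intro z; rw [normaliser, eH, eK, eα, eβ, pow_zero, mul_one]
  exact ⟨⟨P, Q, R, hP.trans_eq eδ.symm, hQ.trans_eq eδ.symm, hR.trans_eq eδ.symm,
    fun z hz => by rw [hN]; exact (hid z hz).1, fun z hz => by rw [hN]; exact (hid z hz).2.1,
    fun z hz => by rw [hN]; exact (hid z hz).2.2⟩⟩

/-- Lemma 2.6: a witness for `(0, 0, k, l, 0)`, `k, l ≥ 1` (`Q = 0`). [cite: RhinViola2005, Lemma 2.6] -/
theorem nonempty_witness_zero_zero_k_l_zero {k l : ℕ} (hk : 1 ≤ k) (hl : 1 ≤ l) : Nonempty (Witness 0 0 k l 0) := by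
  obtain ⟨P, R, hP, hR, hid⟩ := lemma26 hk hl
  obtain ⟨eH, eK, eα, eβ, eδ⟩ := exponents_zero_zero_k_l_zero k l
  have hN : ∀ z : ℝ, normaliser 0 0 k l 0 z =
      (Nat.lcmUpto (max k l) : ℝ) * Nat.lcmUpto (max k l) * z ^ (k + l) * (z - 1) ^ (k + l) := by
    intro z; rw [normaliser, eH, eK, eα, eβ]
  exact ⟨⟨P, 0, R, hP.trans_eq eδ.symm, by simp, hR.trans_eq eδ.symm,
    fun z hz => by rw [hN, (hid z hz).1]; simp, fun z hz => by rw [hN, (hid z hz).2.1]; simp,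
    fun z hz => by rw [(hid z hz).2.2]; simp⟩⟩

/-- Lemma 2.4: a witness for `(0, 0, k, 0, 0)`, `k ≥ 1` (`Q = 0`). [cite: RhinViola2005, Lemma 2.4] -/
theorem nonempty_witness_zero_zero_k_zero_zero {k : ℕ} (hk : 1 ≤ k) : Nonempty (Witness 0 0 k 0 0) := by
  obtain ⟨P, R, hP, hR, hid⟩ := lemma24 hk
  obtain ⟨eH, eK, eα, eβ, eδ⟩ := exponents_zero_zero_k_l_zero k 0
  rw [Nat.max_eq_left (Nat.zero_le k)] at eH eK
  rw [Nat.add_zero] at eα eβ eδ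
  have hN : ∀ z : ℝ, normaliser 0 0 k 0 0 z = (Nat.lcmUpto k : ℝ) * Nat.lcmUpto k * z ^ k * (z - 1) ^ k := by
    intro z; rw [normaliser, eH, eK, eα, eβ]
  exact ⟨⟨P, 0, R, hP.trans_eq eδ.symm, by simp, hR.trans_eq eδ.symm,
    fun z hz => by rw [hN, (hid z hz).1]; simp, fun z hz => by rw [hN, (hid z hz).2.1]; simp,
    fun z hz => by rw [(hid z hz).2.2]; simp⟩⟩

/-- Lemma 2.5: a witness for `(0, 0, 0, l, 0)`, `l ≥ 1`, from the one for `(0,0,l,0,0)` by `λ`.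
[cite: RhinViola2005, Lemma 2.5] -/
theorem nonempty_witness_zero_zero_zero_l_zero {l : ℕ} (hl : 1 ≤ l) : Nonempty (Witness 0 0 0 l 0) := by
  obtain ⟨W⟩ := nonempty_witness_zero_zero_k_zero_zero hl
  obtain ⟨eH, eK, eα, eβ, eδ⟩ := exponents_lam 0 0 l 0 0
  exact ⟨W.transfer eH eK eα eβ eδ (fun z hz => I_zero_zero_zero_l_zero hz l)
    (fun z hz => I1_zero_zero_zero_l_zero hz l) (fun z _ => I2_zero_zero_zero_l_zero z hl)⟩

/-! ### Lemma 2.2 (both cases) -/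

/-- `d_a d_b = d_{max{a,b}} d_{min{a,b}}`. [folklore] -/
theorem lcmUpto_mul_eq_max_min (a b : ℕ) :
    Nat.lcmUpto a * Nat.lcmUpto b = Nat.lcmUpto (max a b) * Nat.lcmUpto (min a b) := by
  rcases le_total a b with h | h
  · rw [max_eq_right h, min_eq_left h, mul_comm]
  · rw [max_eq_left h, min_eq_right h]

/-- Lemma 2.2, case `j + k < m`: a witness with `Q = R = 0`. [cite: RhinViola2005, Lemma 2.2] -/
theorem nonempty_witness_of_lt {h j k l m : ℕ} (hm : j + k < m) : Nonempty (Witness h j k l m) := by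
  obtain ⟨T, hTdeg, hT⟩ := exists_poly_eq_lcm_mul_zpow_mul_I0_of_lt' (h := h) (l := l) hm
  obtain ⟨hH', hK', hα⟩ := exponents_of_lt (h := h) (l := l) hm
  have hlm : l + m ≤ delta h j k l m := ((delta_le_iff h j k l m _).1 le_rfl).2.2.2.2.2
  -- `d_a d_b ∣ d_H d_K`
  have hdvd : Nat.lcmUpto (m + h - k) * Nat.lcmUpto (l + m - j) ∣
      Nat.lcmUpto (bigH h j k l m) * Nat.lcmUpto (bigK h j k l m) := by
    rw [lcmUpto_mul_eq_max_min, max_comm, min_comm]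
    exact mul_dvd_mul (lcmUpto_dvd_lcmUpto_of_le hH') (lcmUpto_dvd_lcmUpto_of_le hK')
  set r : ℕ := Nat.lcmUpto (bigH h j k l m) * Nat.lcmUpto (bigK h j k l m) /
    (Nat.lcmUpto (m + h - k) * Nat.lcmUpto (l + m - j)) with hr
  have hr' : (r : ℝ) * (Nat.lcmUpto (m + h - k) * Nat.lcmUpto (l + m - j) : ℕ) =
      (Nat.lcmUpto (bigH h j k l m) * Nat.lcmUpto (bigK h j k l m) : ℕ) := by
    rw [hr]; exact_mod_cast Nat.div_mul_cancel hdvd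
  refine ⟨⟨C (r : ℤ) * X ^ 0 * (X - 1) ^ beta h j k l m * T, 0, 0, ?_, by simp, by simp, fun z hz => ?_,
    fun z hz => ?_, fun z hz => ?_⟩⟩
  · refine (natDegree_C_mul_X_pow_mul_le _ _ _ _).trans ?_
    have hb : beta h j k l m = k + l - h := rfl
    omega
  · rw [I_eq_I0_of_lt h (Or.inl hm), aeval_C_mul_X_pow_mul, hT z hz.le, normaliser, hα]
    simp only [map_zero, zero_mul, sub_zero, pow_zero, mul_one, Int.cast_natCast]
    rw [show (z : ℝ) ^ ((l : ℤ) + m) = z ^ (l + m) by rw [← Nat.cast_add, zpow_natCast]]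
    push_cast at hr' ⊢
    linear_combination (z ^ (l + m) * (z - 1) ^ beta h j k l m * I0 z h j k l m) * hr'.symm
  · rw [I1_of_lt h hm]; simp
  · rw [I2_of_lt h hm]; simp

/-- Lemma 2.2, case `l + m < j`: by `λ` from the previous case (`I^{(0)}` via `I0_lam`; `I^{(1)} = I^{(2)} = 0`
directly). [cite: RhinViola2005, Lemma 2.2] -/
theorem nonempty_witness_of_lt' {h j k l m : ℕ} (hj : l + m < j) : Nonempty (Witness h j k l m) := by
  obtain ⟨W⟩ := nonempty_witness_of_lt (h := h) (j := m) (k := l) (l := k) (m := j) (by omega)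
  obtain ⟨eH, eK, eα, eβ, eδ⟩ := exponents_lam h j k l m
  refine ⟨W.transfer eH.symm eK.symm eα.symm eβ.symm eδ.symm (fun z hz => ?_) (fun z hz => ?_) (fun z hz => ?_)⟩
  · rw [I_eq_I0_of_lt h (Or.inr hj), I_eq_I0_of_lt h (Or.inl (by omega)), I0_lam hz.le h m l k j]
  · rw [I1_of_lt' h hj, I1_of_lt h (by omega)]
  · rw [I2_of_lt' h hj, I2_of_lt h (by omega)]

/-! ### The induction (pp. 405–410) -/

/-- **Theorem 2.1 holds for every tuple** (induction on `h+j+k+l+m`). [cite: RhinViola2005, Theorem 2.1 (proof), pp. 405–410] -/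
theorem nonempty_witness (n : ℕ) : ∀ h j k l m : ℕ, h + j + k + l + m = n → Nonempty (Witness h j k l m) := by
  induction n using Nat.strong_induction_on with
  | _ n IH =>
  intro h j k l m hn
  by_cases hlt : j + k < m
  · exact nonempty_witness_of_lt hlt
  by_cases hlt' : l + m < j
  · exact nonempty_witness_of_lt' hlt'
  by_cases hkm : 0 < k ∧ 0 < m
  · obtain ⟨k', rfl⟩ : ∃ k', k = k' + 1 := ⟨k - 1, by omega⟩
    obtain ⟨m', rfl⟩ : ∃ m', m = m' + 1 := ⟨m - 1, by omega⟩
    obtain ⟨W₁⟩ := IH (n - 2) (by omega) h j k' l m' (by omega)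
    obtain ⟨W₂⟩ := IH (n - 1) (by omega) h j k' (l + 1) m' (by omega)
    exact ⟨W₁.km W₂⟩
  by_cases hjl : 0 < j ∧ 0 < l
  · obtain ⟨j', rfl⟩ : ∃ j', j = j' + 1 := ⟨j - 1, by omega⟩
    obtain ⟨l', rfl⟩ : ∃ l', l = l' + 1 := ⟨l - 1, by omega⟩
    obtain ⟨W₁⟩ := IH (n - 2) (by omega) h j' k l' m (by omega)
    obtain ⟨W₂⟩ := IH (n - 1) (by omega) h j' (k + 1) l' m (by omega)
    exact ⟨W₁.jl W₂⟩
  by_cases hhl : 0 < h ∧ 0 < l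
  · obtain ⟨h', rfl⟩ : ∃ h', h = h' + 1 := ⟨h - 1, by omega⟩
    obtain ⟨l', rfl⟩ : ∃ l', l = l' + 1 := ⟨l - 1, by omega⟩
    obtain ⟨W₃⟩ := IH (n - 2) (by omega) h' j k l' m (by omega)
    obtain ⟨W₄⟩ := IH (n - 1) (by omega) h' j k (l' + 1) m (by omega)
    obtain ⟨W₅⟩ := IH (n - 1) (by omega) h' j k l' (m + 1) (by omega)
    exact ⟨W₃.hl W₄ W₅⟩
  by_cases hhk : 0 < h ∧ 0 < k
  · obtain ⟨h', rfl⟩ : ∃ h', h = h' + 1 := ⟨h - 1, by omega⟩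
    obtain ⟨k', rfl⟩ : ∃ k', k = k' + 1 := ⟨k - 1, by omega⟩
    obtain ⟨W₃⟩ := IH (n - 2) (by omega) h' j k' l m (by omega)
    obtain ⟨W₄⟩ := IH (n - 1) (by omega) h' j (k' + 1) l m (by omega)
    obtain ⟨W₅⟩ := IH (n - 1) (by omega) h' (j + 1) k' l m (by omega)
    exact ⟨W₃.hk W₄ W₅⟩
  -- terminal tuples: `km = jl = hl = hk = 0`, `l + m ≥ j`, `j + k ≥ m`
  rcases Nat.eq_zero_or_pos j with hj0 | hjpos
  · subst hj0
    rcases Nat.eq_zero_or_pos k with hk0 | hkpos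
    · subst hk0
      have hm0 : m = 0 := by omega
      subst hm0
      rcases Nat.eq_zero_or_pos l with hl0 | hlpos
      · subst hl0
        exact nonempty_witness_h_j_zero_zero_j h 0
      · have hh0 : h = 0 := by
          by_contra hh; exact hhl ⟨Nat.pos_of_ne_zero hh, hlpos⟩
        subst hh0
        exact nonempty_witness_zero_zero_zero_l_zero hlpos
    · have hh0 : h = 0 := by
        by_contra hh; exact hhk ⟨Nat.pos_of_ne_zero hh, hkpos⟩
      have hm0 : m = 0 := by
        by_contra hm; exact hkm ⟨hkpos, Nat.pos_of_ne_zero hm⟩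
      subst hh0; subst hm0
      rcases Nat.eq_zero_or_pos l with hl0 | hlpos
      · subst hl0
        exact nonempty_witness_zero_zero_k_zero_zero hkpos
      · exact nonempty_witness_zero_zero_k_l_zero hkpos hlpos
  · have hl0 : l = 0 := by
      by_contra hl; exact hjl ⟨hjpos, Nat.pos_of_ne_zero hl⟩
    subst hl0
    have hk0 : k = 0 := by
      by_contra hk; exact hkm ⟨Nat.pos_of_ne_zero hk, by omega⟩
    subst hk0
    have hmj : m = j := by omega
    subst hmj
    exact nonempty_witness_h_j_zero_zero_j h m

/-! ### Theorem 2.1 -/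

/-- **Rhin–Viola 2005, Theorem 2.1.** For all `h, j, k, l, m ≥ 0` there are `P, Q, R ∈ ℤ[X]` with
`max{deg P, deg Q, deg R} ≤ δ` such that for every real `z > 1`, with `H, K, α, β, δ` of (2.9)
(`RhinViola.bigH/bigK/alpha/beta/delta`) and `d_n = lcm(1,…,n)`:
`d_H d_K z^α (z−1)^β I_z(h,j,k,l,m) = P(z) − Q(z) Li₂(1/z)`,
`d_H d_K z^α (z−1)^β I_z^{(1)}(h,j,k,l,m) = R(z) − Q(z) Li₁(1/z)`, and
`d_H d_K z^α (z−1)^β I_z^{(2)}(h,j,k,l,m) = Q(z)`. [cite: RhinViola2005, Theorem 2.1] -/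
theorem theorem21 (h j k l m : ℕ) :
    ∃ P Q R : ℤ[X], P.natDegree ≤ delta h j k l m ∧ Q.natDegree ≤ delta h j k l m ∧
      R.natDegree ≤ delta h j k l m ∧
      ∀ z : ℝ, 1 < z →
        (Nat.lcmUpto (bigH h j k l m) : ℝ) * Nat.lcmUpto (bigK h j k l m) * z ^ alpha h j k l m *
            (z - 1) ^ beta h j k l m * I z h j k l m = aeval z P - aeval z Q * polylogSeries 2 (1 / z) ∧
        (Nat.lcmUpto (bigH h j k l m) : ℝ) * Nat.lcmUpto (bigK h j k l m) * z ^ alpha h j k l m *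
            (z - 1) ^ beta h j k l m * I1 z h j k l m = aeval z R - aeval z Q * polylogSeries 1 (1 / z) ∧
        (Nat.lcmUpto (bigH h j k l m) : ℝ) * Nat.lcmUpto (bigK h j k l m) * z ^ alpha h j k l m *
            (z - 1) ^ beta h j k l m * I2 z h j k l m = aeval z Q := by
  obtain ⟨W⟩ := nonempty_witness _ h j k l m rfl
  exact ⟨W.P, W.Q, W.R, W.degP, W.degQ, W.degR, fun z hz => ⟨W.eqI z hz, W.eqI1 z hz, W.eqI2 z hz⟩⟩

end RhinViola

end Literature.NumberTheory.DiophantineApproximation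

end
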